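import Summits.KontsevichZagierPeriods.KontsevichZagierPeriods.Theses.HyperbolicBloch

/-!
# KontsevichZagierPeriods / HyperbolicBloch — the assembly `Assembly` (stmt-KontsevichZagierPeriods-10685)

Route `KontsevichZagierPeriods/HyperbolicBloch` (weight-2 scissors transfer: the five-term relation of
the Bloch–Wigner dilogarithm as two domain-additivity moves in `ℍ³`), item
stmt-KontsevichZagierPeriods-10685 (`Assembly`, rank 1):

  `TetraSector → ZagierDilogarithmConjecture → OffTetraSectorKernel → KontsevichZagierPeriods`.

Informal content: unfold the summit `KontsevichZagierPeriods` to `[r] − [r'] ∈ KZ.relations` for two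
rational-shape representations of equal value; `KZ.eval ([r] − [r']) = 0` (`KZ.eval_of`), so
`OffTetraSectorKernel` (the kernel form of Conjecture 1 with the `ℚ̄`-ideal-tetrahedron
value-relators adjoined, applied to the standard tetrahedron family `T`, `rfl`) puts `[r] − [r']` in
`KZ.relations ⊔ closure {tetrahedral value-relators}`, and each adjoined relator is discharged by
`TetraSector` fed with `ZagierDilogarithmConjecture` (`sup_le`, `AddSubgroup.closure_le`).

This is VERBATIM the type of the route's kernel-checked deciding theorem
`Summit.KontsevichZagierPeriods.KontsevichZagierPeriods.Theses.HyperbolicBloch.closes`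
(route file rev 6, D-0027 §2.1; axioms `propext`, `Classical.choice`, `Quot.sound`), so the item is
settled by the term `closes`.  The two antecedents `ZagierDilogarithmConjecture` (Zagier's conjecture
on `ℚ`-linear relations among dilogarithm values at algebraic arguments, Neumann 1998 §2.1) and
`OffTetraSectorKernel` (the remainder of the kernel form of Conjecture 1) are OPEN conjectures and are
NOT discharged here: the theorem is the implication, nothing more.  `TetraSector` is the route's
target (stmt-KontsevichZagierPeriods-3468; it follows from the proved crux `FiveTermTransfer` via the
support item `SectorReduction`, not used here).

This module imports the route module `…Theses.HyperbolicBloch`; the gate records the closure as a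
docstring link in the route file (no `Assembly_holds` re-import, which would be an import cycle).

References: M. Kontsevich, D. Zagier, *Periods* (2001), §1.2 (Conjecture 1 and its kernel form);
A. Huber, S. Müller-Stach, *Periods and Nori Motives* (2017), §13.1; W. D. Neumann, *Hilbert's 3rd
problem and invariants of 3-manifolds* (1998), §2.1.
-/

namespace Summit.KontsevichZagierPeriods.HyperbolicBloch

/-- **Assembly of route HyperbolicBloch** (settles stmt-KontsevichZagierPeriods-10685):
`TetraSector → ZagierDilogarithmConjecture → OffTetraSectorKernel → KontsevichZagierPeriods`.
Given the tetrahedral sector of the kernel form (`TetraSector`), its transcendence input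
(`ZagierDilogarithmConjecture`) and the off-sector remainder (`OffTetraSectorKernel`), two
rational-shape KZ representations `r`, `r'` with `value r = value r'` are KZ-equivalent:
`eval ([r] − [r']) = 0`, hence `[r] − [r'] ∈ KZ.relations ⊔ closure {tetrahedral value-relators}`,
and every adjoined relator already lies in `KZ.relations` by `TetraSector`.  Proof: the route's
deciding theorem `closes`, whose type this is by definition of `Assembly`.
[Kontsevich–Zagier 2001, §1.2; Huber–Müller-Stach 2017, §13.1] [folklore] -/
theorem assembly_proof :
    Summit.KontsevichZagierPeriods.KontsevichZagierPeriods.Theses.HyperbolicBloch.Assembly :=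
  Summit.KontsevichZagierPeriods.KontsevichZagierPeriods.Theses.HyperbolicBloch.closes

end Summit.KontsevichZagierPeriods.HyperbolicBloch
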